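import Summits.ResolutionOfSingularities.ResolutionOfSingularities.Theorems.FrobeniusClosingSteerLogFrameSlices
import Literature.AlgebraicGeometry.Hironaka2017.Lib.FrobeniusPBasis
import Literature.AlgebraicGeometry.Resolution.RsopMonomialIdeals
import HarnessLib

/-!
# Crux `Steer` (stmt-ResolutionOfSingularities-16345), chain W4.1 — idea-2's dictionary DICT
# `SimpleIsLogFinal`, piece **3: READING THE FIRST INTEGRALS** — simultaneous weights, the exchange of one
# regular parameter for a homogeneous one, and the Kunz `p`-basis reading of an element killed by a
# DIAGONAL family of derivations

OURS (campaign `res-hironaka`, rung L, slot W4.1, chain W4.1; seat res-D-pv-007 AS res-L0-w41-stub-5; replaces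
the role of no printed item; NOT a statement of the manuscript under review [claim: Hironaka2017, status:
under-review]; AI-produced, weaker than expert review). Theses-free, definition-free, pure commutative algebra
over piece 2 (`…LogFrameSlices`), the lane library LIB-03 (Kunz `p`-basis, `Lib/FrobeniusPBasis.lean`) and the
tree's `IsRsopPart` (`Resolution/RsopMonomialIdeals.lean`).

## Results (namespace `…SwitchingDichotomy.LogFrame`)

* `exists_simultaneous_eigen_decomposition` — a finite family of COMMUTING derivations `ε j` with `ε j ^[p] = ε j`
  decomposes every element of an `ε`-stable additive subgroup `P` into finitely many SIMULTANEOUS eigenvectors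
  in `P` with prime-field weights (iterate piece 2's `exists_eigen_decomposition`).
* `exists_span_update_eq` (**EXCHANGE**) — `y` part of a regular system of parameters generating `𝔪`; if `y m₀`
  is congruent modulo `(y m : m ≠ m₀)` to a finite sum of elements `u l ∈ 𝔪`, then for some `l` the family
  `y[m₀ ↦ u l]` still generates `𝔪` (primality of `(y m : m ≠ m₀)` and locality).
* `apply_prod_pow_of_diag` — a derivation DIAGONAL on `y` (`θ (y i) = w i * y i`, `w i ∈ ℕ`) multiplies the monomial
  `y^α` by the weight `∑ α i * w i`.
* `exists_pow_mul_eq_sum_of_diag` (**KUNZ READING**) — `A` regular local of characteristic `p`, F-finite with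
  perfect residue field, `y` a regular system of parameters; a family of diagonal derivations with natural
  weights kills `g`, and the only exponent vectors `α ∈ [0,p)^n` all of whose weights vanish mod `p` are the
  `α = (α m₀ · ν) mod p` for a fixed `ν` with `ν m₀ = 1`. Then `D ^ p * g = ∑_{k<p} (e k) ^ p * w₀ ^ k` with `D ≠ 0`
  and `w₀ = ∏ y i ^ ν i`: `g` is a `p`-th-power combination of the powers of the MONOMIAL `w₀` (Kunz: `A` is free
  over `A^p` on the monomials `y^α`; a derivation kills `A^p`, so `θ g = ∑ c_α (∑ α i w i) y^α` and independence
  forces `c_α = 0` off the line `α ≡ k ν`; `w₀ ^ k = (∏ y i ^ ⌊kν i/p⌋)^p · y^{(kν) mod p}`).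

Sources: E. Kunz, Amer. J. Math. 91 (1969), Thm. 2.1 (the `p`-basis); H. Matsumura, *Commutative Ring Theory*,
§25, §30; folklore (weights of diagonal derivations / `μ_p`-gradings). [cite: Kunz1969, Thm. 2.1]
[cite: Matsumura1987, §25, §30] [folklore]
-/

noncomputable section

-- `Summit.<S>.<S>.…` duplicates the summit name by design (single-problem summit).
set_option linter.dupNamespace false
set_option autoImplicit false

namespace Summit.ResolutionOfSingularities.ResolutionOfSingularities.Theorems.SwitchingDichotomy

namespace LogFrame

open IsLocalRing Finset
open Literature.AlgebraicGeometry.Resolution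
open Literature.AlgebraicGeometry.Hironaka2017.S02Preliminaries

variable {A : Type*} [CommRing A]

/-! ## §0 Simultaneous weights for a commuting family with `ε^[p] = ε` -/

section Simultaneous

variable (p : ℕ) [Fact p.Prime] [CharP A p] {κ : Type*} (ε : κ → Derivation ℤ A A)

/-- **Simultaneous eigen-decomposition.** For a finite set `T` of indices, pairwise commuting derivations `ε j`
(`j ∈ T`) with `ε j ^[p] = ε j`, and an additive subgroup `P` stable under every `ε j` (`j ∈ T`): every `a ∈ P` is
a finite sum of elements of `P` that are simultaneous eigenvectors of the `ε j`, `j ∈ T`, with natural-number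
weights. [cite: Matsumura1987, §25 (restricted Lie algebra of derivations)] [folklore] -/
theorem exists_simultaneous_eigen_decomposition [DecidableEq κ]
    (hε : ∀ j a, (⇑(ε j))^[p] a = ε j a) (hcomm : ∀ j j' a, ε j (ε j' a) = ε j' (ε j a))
    (P : AddSubgroup A) (hP : ∀ j, ∀ b ∈ P, ε j b ∈ P) (T : Finset κ) {a : A} (ha : a ∈ P) :
    ∃ (N : ℕ) (u : Fin N → A) (χ : Fin N → κ → ℕ), (∑ l, u l = a) ∧ (∀ l, u l ∈ P) ∧
      ∀ l, ∀ j ∈ T, ε j (u l) = (χ l j : A) * u l := by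
  classical
  induction T using Finset.induction_on with
  | empty => exact ⟨1, fun _ => a, fun _ _ => 0, by simp, fun _ => ha, fun _ j hj => absurd hj (by simp)⟩
  | insert j T hj ih =>
    obtain ⟨N, u, χ, hsum, huP, hu⟩ := ih
    -- decompose each `u l` along `ε j`
    have hdec : ∀ l, ∃ e : ZMod p → A, (∑ c, e c = u l) ∧ (∀ c, ε j (e c) = (c.val : A) * e c) ∧
        (∀ c, e c ∈ P) ∧ ∀ c, ∀ j' ∈ T, ε j' (e c) = (χ l j' : A) * e c := by
      intro l
      obtain ⟨e, h1, h2, h3, h4⟩ := exists_eigen_decomposition p (ε j) (hε j) (u l)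
      exact ⟨e, h1, h2, fun c => h3 P (hP j) (huP l) c,
        fun c j' hj' => h4 (ε j' : A →+ A) (χ l j') (fun b => hcomm j' j b) (hu l j' hj') c⟩
    choose e he1 he2 he3 he4 using hdec
    -- reindex the family `(l, c) ↦ e l c` by `Fin (N * p)`
    let σ : Fin N × ZMod p ≃ Fin (Fintype.card (Fin N × ZMod p)) := Fintype.equivFin _
    refine ⟨Fintype.card (Fin N × ZMod p), fun m => e (σ.symm m).1 (σ.symm m).2,
      fun m j' => if j' = j then ((σ.symm m).2).val else χ (σ.symm m).1 j', ?_, fun m => he3 _ _, ?_⟩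
    · show ∑ m, e (σ.symm m).1 (σ.symm m).2 = a
      rw [Fintype.sum_equiv σ.symm (fun m => e (σ.symm m).1 (σ.symm m).2) (fun q => e q.1 q.2)
        (fun _ => rfl), Fintype.sum_prod_type, ← hsum]
      exact Finset.sum_congr rfl fun l _ => he1 l
    · intro m j' hj'
      show ε j' (e (σ.symm m).1 (σ.symm m).2) =
        ((if j' = j then ((σ.symm m).2).val else χ (σ.symm m).1 j' : ℕ) : A) * e (σ.symm m).1 (σ.symm m).2
      by_cases hjj : j' = j
      · subst hjj
        rw [if_pos rfl]
        exact he2 _ _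
      · rw [if_neg hjj]
        exact he4 _ _ j' ((Finset.mem_insert.mp hj').resolve_left hjj)

end Simultaneous

/-! ## §1 The exchange of one regular parameter -/

section Exchange

variable [IsLocalRing A] {n : ℕ}

/-- **Exchange.** `y : Fin n → A` part of a regular system of parameters with `(y) = 𝔪`, `m₀` an index and
`u : Fin N → A` elements of `𝔪` with `y m₀ ≡ ∑ u l` modulo `𝔞 = (y m : m ≠ m₀)`. Then some `y[m₀ ↦ u l]` generates
`𝔪`: writing `u l ≡ s l · y m₀ (mod 𝔞)`, `(1 - ∑ s l) y m₀ ∈ 𝔞` with `𝔞` prime and `y m₀ ∉ 𝔞` forces `∑ s l ∉ 𝔪`,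
so some `s l` is a unit. [cite: Matsumura1987, Thm. 14.2 (regular systems of parameters)] [folklore] -/
theorem exists_span_update_eq (y : Fin n → A) (hz : IsRsopPart y)
    (hy : Ideal.span (Set.range y) = maximalIdeal A) (m₀ : Fin n) {N : ℕ} (u : Fin N → A)
    (hu : ∀ l, u l ∈ maximalIdeal A)
    (hsum : y m₀ - ∑ l, u l ∈ Ideal.span (y '' {m | m ≠ m₀})) :
    ∃ l, Ideal.span (Set.range (Function.update y m₀ (u l))) = maximalIdeal A := by
  classical
  set 𝔞 : Ideal A := Ideal.span (y '' {m | m ≠ m₀}) with h𝔞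
  -- `𝔞` is prime and does not contain `y m₀`
  have hprime : 𝔞.IsPrime := by
    let σ := (Fintype.equivFin {m : Fin n // m ≠ m₀}).symm
    have hι : Function.Injective (fun l => ((σ l : {m : Fin n // m ≠ m₀}) : Fin n)) :=
      Subtype.val_injective.comp σ.injective
    have h := (hz.comp _ hι).isPrime_span_range
    have hr : Set.range (y ∘ fun l => ((σ l : {m : Fin n // m ≠ m₀}) : Fin n)) = y '' {m | m ≠ m₀} := by
      ext a
      constructor
      · rintro ⟨l, rfl⟩
        exact ⟨(σ l : Fin n), (σ l).2, rfl⟩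
      · rintro ⟨m, hm, rfl⟩
        exact ⟨σ.symm ⟨m, hm⟩, by simp⟩
    rwa [hr] at h
  have hnot : y m₀ ∉ 𝔞 := hz.not_mem_span_image (S := {m | m ≠ m₀}) (by simp)
  -- each `u l ∈ 𝔪 = 𝔞 + (y m₀)`: `u l - s l * y m₀ ∈ 𝔞`
  have hdecomp : ∀ l, ∃ s : A, u l - s * y m₀ ∈ 𝔞 := by
    intro l
    have hl : u l ∈ Ideal.span (Set.range y) := hy ▸ hu l
    obtain ⟨k, hk⟩ := Ideal.mem_span_range_iff_exists_fun.mp hl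
    refine ⟨k m₀, ?_⟩
    rw [← hk, ← Finset.sum_erase_add _ _ (Finset.mem_univ m₀), add_sub_cancel_right]
    refine Ideal.sum_mem _ fun m hm => Ideal.mul_mem_left _ _ (Ideal.subset_span ⟨m, ?_, rfl⟩)
    exact (Finset.mem_erase.mp hm).1
  choose s hs using hdecomp
  -- `(1 - ∑ s l) * y m₀ ∈ 𝔞`, hence `1 - ∑ s l ∈ 𝔞 ⊆ 𝔪` and `∑ s l` is a unit
  have hone : (1 - ∑ l, s l) * y m₀ ∈ 𝔞 := by
    have h1 : (1 - ∑ l, s l) * y m₀ = (y m₀ - ∑ l, u l) + ∑ l, (u l - s l * y m₀) := by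
      rw [Finset.sum_sub_distrib, ← Finset.sum_mul]; ring
    rw [h1]
    exact Ideal.add_mem _ hsum (Ideal.sum_mem _ fun l _ => hs l)
  have hone' : 1 - ∑ l, s l ∈ maximalIdeal A := by
    have h := (hprime.mem_or_mem hone).resolve_right hnot
    have hle : 𝔞 ≤ maximalIdeal A := by
      rw [h𝔞, ← hy]
      exact Ideal.span_mono (Set.image_subset_range _ _)
    exact hle h
  have hunit : ∃ l, IsUnit (s l) := by
    by_contra hcon
    push Not at hcon
    have hmem : ∑ l, s l ∈ maximalIdeal A :=
      Ideal.sum_mem _ fun l _ => (mem_maximalIdeal _).mpr (hcon l)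
    have : (1 : A) ∈ maximalIdeal A := by
      have h := Ideal.add_mem _ hone' hmem
      rwa [sub_add_cancel] at h
    exact (maximalIdeal.isMaximal A).ne_top ((Ideal.eq_top_iff_one _).mpr this)
  obtain ⟨l, hl⟩ := hunit
  refine ⟨l, le_antisymm ?_ ?_⟩
  · rw [Ideal.span_le]
    rintro _ ⟨m, rfl⟩
    by_cases hm : m = m₀
    · subst hm
      rw [Function.update_self]
      exact hu l
    · rw [Function.update_of_ne hm, ← hy]
      exact Ideal.subset_span ⟨m, rfl⟩
  · -- `𝔞 ≤ span` and `u l ∈ span`, hence `y m₀ = (s l)⁻¹ (u l - (u l - s l y m₀)) ∈ span`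
    have h𝔞le : 𝔞 ≤ Ideal.span (Set.range (Function.update y m₀ (u l))) := by
      rw [h𝔞, Ideal.span_le]
      rintro _ ⟨m, hm, rfl⟩
      have hm' : m ≠ m₀ := hm
      exact Ideal.subset_span ⟨m, by rw [Function.update_of_ne hm']⟩
    have hul : u l ∈ Ideal.span (Set.range (Function.update y m₀ (u l))) :=
      Ideal.subset_span ⟨m₀, by rw [Function.update_self]⟩
    have hym₀ : y m₀ ∈ Ideal.span (Set.range (Function.update y m₀ (u l))) := by
      have h1 : y m₀ = ↑(hl.unit⁻¹) * (u l - (u l - s l * y m₀)) := by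
        rw [sub_sub_cancel, ← mul_assoc, IsUnit.val_inv_mul, one_mul]
      rw [h1]
      exact Ideal.mul_mem_left _ _ (Ideal.sub_mem _ hul (h𝔞le (hs l)))
    rw [← hy, Ideal.span_le]
    rintro _ ⟨m, rfl⟩
    by_cases hm : m = m₀
    · subst hm
      exact hym₀
    · exact Ideal.subset_span ⟨m, by rw [Function.update_of_ne hm]⟩

end Exchange

/-! ## §2 Diagonal derivations and the Kunz reading -/

section Reading

variable {n : ℕ}

/-- **Weights of diagonal derivations.** If `θ (y i) = w i * y i` with natural weights `w`, then
`θ (∏_{i ∈ s} y i ^ α i) = (∑_{i ∈ s} α i * w i) * ∏_{i ∈ s} y i ^ α i`. [folklore] -/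
theorem apply_prod_pow_of_diag (θ : Derivation ℤ A A) (y : Fin n → A) (w : Fin n → ℕ)
    (hθ : ∀ i, θ (y i) = (w i : A) * y i) (α : Fin n → ℕ) (s : Finset (Fin n)) :
    θ (∏ i ∈ s, y i ^ α i) = ((∑ i ∈ s, α i * w i : ℕ) : A) * ∏ i ∈ s, y i ^ α i := by
  classical
  induction s using Finset.induction_on with
  | empty => simp
  | insert j s hj ih =>
    rw [Finset.prod_insert hj, Finset.sum_insert hj, Derivation.leibniz, ih, θ.leibniz_pow, hθ]
    simp only [smul_eq_mul, nsmul_eq_mul]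
    -- `y j ^ α j * (W * P) + P * (α j * y j ^ (α j - 1) * (w j * y j)) = (α j * w j + W) * (y j ^ α j * P)`
    rcases Nat.eq_zero_or_pos (α j) with h0 | hpos
    · rw [h0]; simp
    · obtain ⟨b, hb⟩ : ∃ b, α j = b + 1 := ⟨α j - 1, (Nat.sub_add_cancel hpos).symm⟩
      rw [hb, Nat.add_sub_cancel, pow_succ]
      push_cast
      ring

variable (p : ℕ) [Fact p.Prime] [CharP A p]

/-- A derivation kills the Frobenius-power subring `ρ(A)`. [cite: Matsumura1987, §25] -/
theorem apply_eq_zero_of_mem_frobeniusPowerSubring (θ : Derivation ℤ A A) {c : A}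
    (hc : c ∈ frobeniusPowerSubring A p 1) : θ c = 0 := by
  obtain ⟨b, rfl⟩ := mem_frobeniusPowerSubring_iff.mp hc
  rw [pow_one, θ.leibniz_pow, ← Nat.cast_smul_eq_nsmul A p, CharP.cast_eq_zero A p, zero_smul]

/-- **The Kunz reading.** `A` regular local of characteristic `p`, F-finite with perfect residue field, `y` a
regular system of parameters (`(y) = 𝔪`, `n = emb dim`); `θ k` (`k ∈ κ`) derivations DIAGONAL on `y` with natural
weights `w k`, all killing `g`; and a vector `ν` with `ν m₀ = 1` such that every `α ∈ [0,p)^n` whose weights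
`∑ α i * w k i` are ALL divisible by `p` satisfies `α i = (α m₀ * ν i) mod p`. Then
`D ^ p * g = ∑_{k<p} (e k) ^ p * (∏ y i ^ ν i) ^ k` for some `D ≠ 0` and `e`. [cite: Kunz1969, Thm. 2.1]
[cite: Matsumura1987, §25, §30] [folklore] -/
theorem exists_pow_mul_eq_sum_of_diag [IsRegularLocalRing A] [PerfectField (ResidueField A)]
    (hF : IsFFinite p 1 A) (y : Fin n → A) (hy : Ideal.span (Set.range y) = maximalIdeal A)
    (hn : (maximalIdeal A).spanFinrank = n) {κ : Type*} (θ : κ → Derivation ℤ A A) (w : κ → Fin n → ℕ)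
    (hθ : ∀ k i, θ k (y i) = (w k i : A) * y i) {g : A} (hg : ∀ k, θ k g = 0) (m₀ : Fin n) (ν : Fin n → ℕ)
    (hν : ν m₀ = 1)
    (hsolve : ∀ α : Fin n → ℕ, (∀ i, α i < p) → (∀ k, p ∣ ∑ i, α i * w k i) →
      ∀ i, α i = (α m₀ * ν i) % p) :
    ∃ (D : A) (e : Fin p → A), D ≠ 0 ∧
      D ^ p * g = ∑ k : Fin p, (e k) ^ p * (∏ i, y i ^ ν i) ^ (k : ℕ) := by
  classical
  have hp : p.Prime := Fact.out
  haveI := isDomain_of_isRegularLocalRing (R := A)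
  have hp1 : p ^ 1 = p := pow_one p
  -- the Kunz basis and the coordinates of `g`
  obtain ⟨b, hb⟩ := exists_basis_frobeniusPower_monomials (p := p) hn y hy hF
  set c : (Fin n → Fin (p ^ 1)) → frobeniusPowerSubring A p 1 := fun α => b.repr g α with hc
  have hgsum : g = ∑ α, (c α : A) * ∏ i, y i ^ (α i : ℕ) := by
    conv_lhs => rw [← b.sum_repr g]
    exact Finset.sum_congr rfl fun α _ => by rw [hb, Subring.smul_def, smul_eq_mul]
  -- Step 1: the support of `c` is on the line `α = (α m₀ * ν) mod p`
  have hsupp : ∀ α, c α ≠ 0 → ∀ i, ((α i : ℕ)) = ((α m₀ : ℕ) * ν i) % p := by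
    intro α hα
    refine hsolve (fun i => (α i : ℕ)) (fun i => (α i).isLt.trans_eq hp1) fun k => ?_
    -- apply `θ k` to the expansion: `0 = ∑ (c α * N α) y^α`, independence, and `c α ≠ 0`
    have hzero : ∑ β : Fin n → Fin (p ^ 1), ((⟨(c β : A) * ((∑ i, (β i : ℕ) * w k i : ℕ) : A),
        Subring.mul_mem _ (c β).2 (natCast_mem _ _)⟩ : frobeniusPowerSubring A p 1) : A) *
          ∏ i, y i ^ (β i : ℕ) =
        ∑ β : Fin n → Fin (p ^ 1), ((0 : frobeniusPowerSubring A p 1) : A) * ∏ i, y i ^ (β i : ℕ) := by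
      have h := hg k
      rw [hgsum, map_sum] at h
      simp only [ZeroMemClass.coe_zero, zero_mul, Finset.sum_const_zero]
      rw [← h]
      refine Finset.sum_congr rfl fun β _ => ?_
      rw [Derivation.leibniz, apply_eq_zero_of_mem_frobeniusPowerSubring p (θ k) (c β).2, smul_zero, add_zero,
        smul_eq_mul, apply_prod_pow_of_diag (θ k) y (w k) (hθ k)]
      ring
    have heq := eq_of_sum_smul_monomials_eq (p := p) hn y hy 1 hzero
    have hα' := congrArg (fun s => ((s α : frobeniusPowerSubring A p 1) : A)) heq
    simp only [ZeroMemClass.coe_zero] at hα'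
    rcases mul_eq_zero.mp hα' with h0 | h0
    · exact absurd (Subtype.ext h0) hα
    · exact (CharP.cast_eq_zero_iff A p _).mp h0
  -- Step 2: the line, parametrised by `k = α m₀`
  let Am : Fin p → (Fin n → Fin (p ^ 1)) := fun k i =>
    ⟨((k : ℕ) * ν i) % p, (Nat.mod_lt _ hp.pos).trans_eq hp1.symm⟩
  have hAm : ∀ k i, ((Am k i : ℕ)) = ((k : ℕ) * ν i) % p := fun k i => rfl
  have hAm_inj : Function.Injective Am := by
    intro k k' h
    have h0 := congrArg (fun α => ((α m₀ : ℕ))) h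
    simp only [hAm, hν, mul_one, Nat.mod_eq_of_lt k.isLt, Nat.mod_eq_of_lt k'.isLt] at h0
    exact Fin.ext h0
  have hline : ∀ α, c α ≠ 0 → α ∈ Finset.univ.image Am := by
    intro α hα
    refine Finset.mem_image.mpr ⟨⟨(α m₀ : ℕ), (α m₀).isLt.trans_eq hp1⟩, Finset.mem_univ _, ?_⟩
    funext i
    exact Fin.ext (by rw [hAm, ← hsupp α hα i])
  have hgsum' : g = ∑ k : Fin p, (c (Am k) : A) * ∏ i, y i ^ ((Am k i : ℕ)) := by
    rw [hgsum, ← Finset.sum_image (f := fun α => (c α : A) * ∏ i, y i ^ (α i : ℕ))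
      (fun k _ k' _ h => hAm_inj h)]
    symm
    refine Finset.sum_subset (Finset.subset_univ _) fun α _ hα => ?_
    have : c α = 0 := by
      by_contra h
      exact hα (hline α h)
    rw [this, ZeroMemClass.coe_zero, zero_mul]
  -- Step 3: `w₀ ^ k = N k ^ p * y^(Am k)` with `N k = ∏ y i ^ ((k ν i) / p)`
  have hpow : ∀ k : Fin p, (∏ i, y i ^ ν i) ^ (k : ℕ) =
      (∏ i, y i ^ (((k : ℕ) * ν i) / p)) ^ p * ∏ i, y i ^ ((Am k i : ℕ)) := by
    intro k
    rw [← Finset.prod_pow, ← Finset.prod_pow, ← Finset.prod_mul_distrib]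
    refine Finset.prod_congr rfl fun i _ => ?_
    rw [hAm, ← pow_mul, ← pow_mul, ← pow_add, mul_comm (ν i), mul_comm (((k : ℕ) * ν i) / p) p,
      Nat.div_add_mod]
  have hN0 : ∀ k : Fin p, (∏ i, y i ^ (((k : ℕ) * ν i) / p)) ≠ 0 := fun k =>
    Finset.prod_ne_zero_iff.mpr fun i _ => pow_ne_zero _ (by
      intro h
      have hz : IsRsopPart y := by
        simpa using isRsopPart_comp_of_rsop hn y hy id Function.injective_id
      exact hz.ne_zero i h)
  -- the `p`-th roots `d k` of the coefficients
  have hd : ∀ k : Fin p, ∃ d : A, d ^ p = (c (Am k) : A) := fun k => by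
    obtain ⟨d, hd⟩ := mem_frobeniusPowerSubring_iff.mp (c (Am k)).2
    exact ⟨d, by rw [← hd, pow_one]⟩
  choose d hd using hd
  -- `D := ∏ N k`; `D = N k * M k`
  refine ⟨∏ k : Fin p, ∏ i, y i ^ (((k : ℕ) * ν i) / p),
    fun k => d k * ∏ k' ∈ Finset.univ.erase k, ∏ i, y i ^ (((k' : ℕ) * ν i) / p),
    Finset.prod_ne_zero_iff.mpr fun k _ => hN0 k, ?_⟩
  rw [hgsum', Finset.mul_sum]
  refine Finset.sum_congr rfl fun k _ => ?_
  rw [hpow k, ← Finset.mul_prod_erase _ _ (Finset.mem_univ k), mul_pow, mul_pow, hd]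
  ring

end Reading

end LogFrame

end Summit.ResolutionOfSingularities.ResolutionOfSingularities.Theorems.SwitchingDichotomy
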